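import Literature.AlgebraicGeometry.Resolution.KummerRadicandsVT
import Literature.AlgebraicGeometry.Resolution.GeneralizedStabilityTrustBase
import HarnessLib

/-!
# Galois extensions of degree `p` of `K(x)^h` in mixed characteristic: `(vE:vF) = p` (Kuhlmann 2010, Prop. 4.6) — proof

Topic: `Literature/AlgebraicGeometry/Resolution` (valued function fields). DISCHARGE of the named
fact `Kuhlmann2010Prop46ValueIndex` (`NormalDegreePDefectlessVTGalois.lean`) = F.-V. Kuhlmann,
*Elimination of ramification I: The generalized stability theorem*, Trans. AMS 362 (2010)
5697–5727 = arXiv:1003.5678, §4.1, **Prop. 4.6** (last assertion), in the specialisation of the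
named fact (an algebraically closed `K` of characteristic `0`):

> **Proposition 4.6.** Let `K`, `F` and `E` be as in the value-transcendental case of
> Proposition 4.1, and assume that `char K = 0`. Then `E = F(ϑ)` where `ϑ^p = x^m u`, with
> `m ∈ {0,…,p−1}` and `u ∈ K[x,x⁻¹]` a `1`-unit … Further, `m ≠ 0` or `I ≠ ∅`. In both cases,
> `(vE:vF) = p`.
> *Proof.* We can assume that `E|F` is of the form (10) [Kummer: `E = F(ϑ)`, `ϑ^p = a ∈ F`].
> Since `vF = vK ⊕ ℤvx` and `F̄ = K̄`, we can write `a = c x^k u` where `k ∈ ℤ`, `c ∈ K` and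
> `u ∈ F` a `1`-unit. Using (11) and our assumption that `K` is closed under `p`-th roots, we
> may replace `a` by `x^m u` where `m = (k mod p)`. … If `m ≠ 0`, then `vϑ = (m/p)vx ∉ vF`.
> Assume that `m = 0`. … This yields `vη = (1/p)vc_j − vC + (j/p)vx ∉ vK ⊕ ℤvx = vF`. In all
> cases, we find as in the proof of Proposition 4.5 that `(vE:vF) = p`.

## Content (everything PROVED)

* `exists_kummer_generator_of_isGaloisStep` — **(10): Kummer generators**: a Galois step
  `F ≤ E` of prime degree `p` over `F ⊇ K`, `K` algebraically closed with `p ≠ 0` in `Ω`, has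
  `ϑ ∈ E ∖ F` with `ϑ^p ∈ F` (Mathlib's `exists_root_adjoin_eq_top_of_isCyclic`, [L] Thm. VI.6.2).
* `relIndex_valueSubgroup_eq_of_isGaloisStep_charZero` — **Prop. 4.6, `(vE:vF) = p`**: with
  `a = ϑ^p = c x^k u` (`exists_eq_mul_zpow_mul_oneUnit_of_mem_henselizedAdjoin`): if `p ∤ k`
  then `v(ϑ) ∉ vF` ("`vϑ = (m/p)vx ∉ vF`"); if `p ∣ k`, rescaling by `c^{1/p}x^{k/p}` gives a
  `1`-unit radicand, and `exists_valuation_not_mem_of_oneUnit_radicand` (`KummerRadicandsVT.lean`)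
  gives `t = ϑw − 1 ∈ E` with `v(t) ∉ vF`, `v(t)^p ∈ vF`; so `p ∣ (vE:vF) ≤ [E:F] = p`
  (`dvd_relIndex_of_pow_mem`, the fundamental inequality `relIndex_mul_relfinrank_le_relfinrank`).
* `Kuhlmann2010Prop46ValueIndex_holds` — the DISCHARGE; and the now unconditional consequences
  `Kuhlmann2010GaloisDegreePDefectlessVT_holds` (Cor. 4.2, value-transcendental case),
  `Kuhlmann2010HenselizedRationalImmediateExt_holds` (the italicized statement of §5 for `K(x)^h`),
  `Kuhlmann2010Lemma55ValueTranscendental_holds` (Lemma 5.5, Case I),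
  `Kuhlmann2010StabilityHenselizedRationalValueTranscendental_holds` and
  `Kuhlmann2010StabilityRankOneValueTranscendental_holds` ((R4) in rank one for a
  value-transcendental generator), `Kuhlmann2010Stability.of_residueLeaves` (Thm. 1.1 over a
  trivially valued ground field from Props. 4.12–4.13 alone).

## Sources

* F.-V. Kuhlmann, *Elimination of ramification I: The generalized stability theorem*, Trans.
  Amer. Math. Soc. 362 (2010) 5697–5727 = arXiv:1003.5678: §1 (1), §2.2, Lemma 2.5, §4 ((10),
  (11), Cor. 4.2), §4.1 (Lemma 4.4, Props. 4.5–4.6), §5 (pp. 18–20). [Kuhlmann2010]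
* Kummer theory: Mathlib (`Mathlib.FieldTheory.KummerExtension`), in place of [L] = S. Lang,
  *Algebra*, Thm. VI.6.2 cited by the source.
-/

noncomputable section

open IsLocalRing

namespace Literature.AlgebraicGeometry.Resolution

universe u

variable {Ω : Type u} [Field Ω] (V : ValuationSubring Ω)

/-! ### Kummer generators of Galois steps of degree `p` -/

section KummerGenerator

omit V in
/-- **Kummer generators** (Kuhlmann 2010, §4, (10): "If `char K = 0` and `K` contains all `p`-th
roots of unity, then `E|F` is a Kummer extension (cf. [L], Theorem 6.2). That is, the extension is
of the form `E = F(ϑ)` where `a := ϑ^p ∈ F`"): for a Galois step `F ≤ E` of prime degree `p`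
inside `Ω`, `K ≤ F` algebraically closed and `p ≠ 0` in `Ω` (so that `F` contains the primitive
`p`-th roots of unity of `K`), there is `ϑ ∈ E`, `ϑ ∉ F`, with `ϑ^p ∈ F`. PROVED from Mathlib's
`exists_root_adjoin_eq_top_of_isCyclic` (a group of prime order is cyclic).
[cite: Kuhlmann2010, Section 4, (10)] -/
theorem exists_kummer_generator_of_isGaloisStep {p : ℕ} [hp : Fact p.Prime] {K F E : Subfield Ω}
    (hK : IsAlgClosed K) (hKF : K ≤ F) (hpΩ : (p : Ω) ≠ 0) (hstep : IsGaloisStep p F E) :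
    ∃ ϑ ∈ E, ϑ ∉ F ∧ ϑ ^ p ∈ F := by
  classical
  obtain ⟨hle, hdeg, hgal⟩ := hstep
  haveI := hgal
  set L : IntermediateField F Ω := Subfield.extendScalars hle with hL
  haveI : FiniteDimensional F L := Module.finite_of_finrank_pos (by rw [hdeg]; exact hp.out.pos)
  haveI : IsCyclic (L ≃ₐ[F] L) :=
    isCyclic_of_prime_card (p := p) (by rw [IsGalois.card_aut_eq_finrank, hdeg])
  obtain ⟨ζ, hζK, hζ⟩ := exists_isPrimitiveRoot_mem_of_isAlgClosed hK hpΩ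
  have hprim : (primitiveRoots (Module.finrank F L) F).Nonempty := by
    refine ⟨⟨ζ, hKF hζK⟩, ?_⟩
    rw [hdeg, mem_primitiveRoots hp.out.pos]
    exact IsPrimitiveRoot.of_map_of_injective (f := algebraMap F Ω) hζ Subtype.val_injective
  obtain ⟨α, hαp, hαtop⟩ := exists_root_adjoin_eq_top_of_isCyclic F L hprim
  rw [hdeg] at hαp
  obtain ⟨a, ha⟩ := hαp
  refine ⟨((α : L) : Ω), (Subfield.mem_extendScalars (h := hle)).mp (α : L).2, ?_, ?_⟩
  · intro hαF
    have hbot : IntermediateField.adjoin F ({α} : Set L) = ⊥ := by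
      rw [IntermediateField.adjoin_simple_eq_bot_iff]
      exact ⟨⟨(α : Ω), hαF⟩, Subtype.ext rfl⟩
    have h1 : Module.finrank F L = 1 := by
      rw [← IntermediateField.finrank_top', ← hαtop, hbot, IntermediateField.finrank_bot]
    rw [hdeg] at h1
    exact hp.out.one_lt.ne' h1
  · have h1 : (((α ^ p : L)) : Ω) = ((α : L) : Ω) ^ p := by simp
    have h2 : ((algebraMap F L a : L) : Ω) = (a : Ω) := rfl
    rw [← h1, ← ha, h2]
    exact a.2

end KummerGenerator

/-! ### Prop. 4.6: the value index -/

section Prop46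

/-- **Kuhlmann 2010, Prop. 4.6 over an algebraically closed `K` of characteristic `0`:
`(vE:vF) = p`** ("In both cases, `(vE:vF) = p`. *Proof.* … we can write `a = c x^k u` … we may
replace `a` by `x^m u` where `m = (k mod p)` … If `m ≠ 0`, then `vϑ = (m/p)vx ∉ vF`. Assume that
`m = 0`. … `vη = (1/p)vc_j − vC + (j/p)vx ∉ vK ⊕ ℤvx = vF`. In all cases, we find as in the proof
of Proposition 4.5 that `(vE:vF) = p`"). Inside the algebraically closed `(Ω, V)` of
characteristic `0` with `char Ωv = p`: `K ≤ Ω` algebraically closed, `x` value-transcendental over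
`K`, `F = K(x)^h` of rank one, `F ≤ E` Galois of degree `p`; then `(vE : vF) = p`. PROVED through
the Kummer generator, Lemma 4.4, §2.2 and the elimination of `p`-th powers
(`KummerOneUnitsVT.lean`, `KummerRadicandsVT.lean`). [cite: Kuhlmann2010, Prop. 4.6] -/
theorem relIndex_valueSubgroup_eq_of_isGaloisStep_charZero [IsAlgClosed Ω] [CharZero Ω] {p : ℕ}
    [hp : Fact p.Prime] [CharP (ResidueField V) p] {K : Subfield Ω} (hK : IsAlgClosed K) {x : Ω}
    (hx : IsValueTranscendentalOver V K x) (hr : IsRankOneValued V (henselizedAdjoin V K x))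
    {E : Subfield Ω} (hstep : IsGaloisStep p (henselizedAdjoin V K x) E) :
    (valueSubgroup (henselizedAdjoin V K x) V).relIndex (valueSubgroup E V) = p := by
  classical
  haveI := hK
  set F := henselizedAdjoin V K x with hFdef
  have hKF : K ≤ F := le_henselizedAdjoin V K x
  have hxF : x ∈ F := mem_henselizedAdjoin_self V K x
  have hp0 : (p : Ω) ≠ 0 := Nat.cast_ne_zero.mpr hp.out.ne_zero
  have hvp : V.valuation (p : Ω) < 1 := valuation_natCast_lt_one_of_charP V p
  -- the constant `C ∈ K`, `C^{p-1} = -p`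
  obtain ⟨Cκ, hCκ⟩ := IsAlgClosed.exists_pow_nat_eq (-(p : K)) (Nat.sub_pos_of_lt hp.out.one_lt)
  set C : Ω := (Cκ : Ω) with hCdef
  have hC : C ^ (p - 1) = -(p : Ω) := by
    have := congrArg (fun z : K => (z : Ω)) hCκ
    simpa using this
  have hCK : C ∈ K := Cκ.2
  -- degrees
  have hle : F ≤ E := hstep.le
  have hrel : Subfield.relfinrank F E = p := hstep.isNormalStep.relfinrank_eq
  have hpos : 0 < Subfield.relfinrank F E := by
    rw [hrel]
    exact hp.out.pos
  ---------------------------------------------------------------- Kummer generator `ϑ`, `a = ϑ^p`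
  obtain ⟨ϑ, hϑE, hϑF, hϑpF⟩ := exists_kummer_generator_of_isGaloisStep hK hKF hp0 hstep
  have hϑ0 : ϑ ≠ 0 := fun h => hϑF (h ▸ F.zero_mem)
  ---------------------------------------------------------------- an element of `E` with value outside `vF`
  obtain ⟨t, htE, ht0, hnot, g, hgF, hg0, htg⟩ : ∃ t ∈ E, t ≠ 0 ∧
      (∀ f ∈ F, f ≠ 0 → V.valuation t ≠ V.valuation f) ∧
      ∃ g ∈ F, g ≠ 0 ∧ V.valuation t ^ p = V.valuation g := by
    -- `a = c x^k u`
    obtain ⟨c, hc, hc0, k, u, huF, hu1, ha⟩ :=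
      exists_eq_mul_zpow_mul_oneUnit_of_mem_henselizedAdjoin V hx hϑpF (pow_ne_zero p hϑ0)
    have hvu : V.valuation u = 1 := by
      have h := Valuation.map_add_eq_of_lt_left V.valuation (x := (1 : Ω)) (y := u - 1)
        (by rw [Valuation.map_one]; exact hu1)
      rw [add_sub_cancel, Valuation.map_one] at h
      exact h
    by_cases hpk : (p : ℤ) ∣ k
    · -- `p ∣ k`: rescale to a `1`-unit radicand
      obtain ⟨κ, hκ⟩ := IsAlgClosed.exists_pow_nat_eq (⟨c, hc⟩ : K) hp.out.pos
      have hκ' : ((κ : K) : Ω) ^ p = c := by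
        have := congrArg (fun z : K => (z : Ω)) hκ
        simpa using this
      have hκ0 : (κ : Ω) ≠ 0 := fun h => hc0 (by rw [← hκ', h, zero_pow hp.out.ne_zero])
      set d : Ω := (κ : Ω) * x ^ (k / p) with hddef
      have hdF : d ∈ F := mul_mem (hKF κ.2) (zpow_mem hxF _)
      have hd0 : d ≠ 0 := mul_ne_zero hκ0 (zpow_ne_zero _ hx.ne_zero)
      have hdp : d ^ p = c * x ^ k := by
        rw [hddef, mul_pow, hκ', ← zpow_natCast (x ^ (k / p)), ← zpow_mul, Int.ediv_mul_cancel hpk]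
      set ϑ₁ : Ω := ϑ * d⁻¹ with hϑ₁def
      have hϑ₁F : ϑ₁ ∉ F := mul_not_mem_of_not_mem hϑF (F.inv_mem hdF) (inv_ne_zero hd0)
      have hm0 : c * x ^ k ≠ 0 := by
        rw [← hdp]
        exact pow_ne_zero p hd0
      have hϑ₁ : ϑ₁ ^ p = 1 + (u - 1) := by
        rw [hϑ₁def, mul_pow, inv_pow, ha, hdp, add_sub_cancel, mul_comm (c * x ^ k) u,
          mul_inv_cancel_right₀ hm0]
      obtain ⟨w, hwF, hne0, hnotw, g, hgF, hg0, hpow⟩ :=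
        exists_valuation_not_mem_of_oneUnit_radicand V hK hx hr hCK hC hp0 hvp hϑ₁F
          (sub_mem huF F.one_mem) hu1 hϑ₁
      exact ⟨ϑ₁ * w - 1,
        sub_mem (mul_mem (mul_mem hϑE (hle (F.inv_mem hdF))) (hle hwF)) E.one_mem,
        hne0, hnotw, g, hgF, hg0, hpow⟩
    · -- `p ∤ k`: `v(ϑ) ∉ vF` already
      refine ⟨ϑ, hϑE, hϑ0, ?_, ϑ ^ p, hϑpF, pow_ne_zero p hϑ0, by rw [map_pow]⟩
      intro f hf hf0 hvf
      have h1 : V.valuation f ^ p = V.valuation (c * x ^ k) := by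
        rw [← hvf, ← map_pow, ha, map_mul (V.valuation) (c * x ^ k) u, hvu, mul_one]
      exact not_valuation_pow_eq_of_not_dvd V hx hp.out.ne_zero hpk hc hc0 hf h1
  ---------------------------------------------------------------- `p ∣ (vE : vF) ≤ p`
  have hvt0 : V.valuation t ≠ 0 := (map_ne_zero _).mpr ht0
  set γ : (ValuationSubring.ValueGroup V)ˣ := Units.mk0 (V.valuation t) hvt0 with hγdef
  have hγE : γ ∈ valueSubgroup E V :=
    (mem_valueSubgroup_iff E V γ).mpr ⟨⟨t, htE⟩, fun h0 => ht0 (congrArg Subtype.val h0), rfl⟩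
  have hγF : γ ∉ valueSubgroup F V := by
    intro hmem
    obtain ⟨f, hf0, hγf⟩ := (mem_valueSubgroup_iff F V γ).mp hmem
    exact hnot f f.2 (fun h0 => hf0 (Subtype.ext h0)) hγf
  have hγp : γ ^ p ∈ valueSubgroup F V := by
    refine (mem_valueSubgroup_iff F V _).mpr ⟨⟨g, hgF⟩, fun h0 => hg0 (congrArg Subtype.val h0), ?_⟩
    rw [Units.val_pow_eq_pow_val, hγdef, Units.val_mk0, htg]
    rfl
  have hdvd : p ∣ (valueSubgroup F V).relIndex (valueSubgroup E V) :=
    dvd_relIndex_of_pow_mem hp.out hγE hγF hγp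
  obtain ⟨he, hf, hef⟩ := relIndex_mul_relfinrank_le_relfinrank V hle hpos
  rw [hrel] at hef
  exact le_antisymm (le_trans (Nat.le_mul_of_pos_right _ hf) hef) (Nat.le_of_dvd he hdvd)

end Prop46

/-! ### Discharge of `Kuhlmann2010Prop46ValueIndex` and consequences -/

/-- **DISCHARGE of `Kuhlmann2010Prop46ValueIndex`** (Kuhlmann 2010, Prop. 4.6, last assertion,
over an algebraically closed `K` of characteristic `0`): `(vE:vF) = p`
(`relIndex_valueSubgroup_eq_of_isGaloisStep_charZero`). PROVED. [cite: Kuhlmann2010, Prop. 4.6] -/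
theorem Kuhlmann2010Prop46ValueIndex_holds : Kuhlmann2010Prop46ValueIndex.{u} := by
  intro Ω _ _ _ V p _ hp K hK x hx hr E hstep
  haveI : Fact p.Prime := ⟨hp⟩
  exact relIndex_valueSubgroup_eq_of_isGaloisStep_charZero V hK hx hr hstep

/-- **DISCHARGE of `Kuhlmann2010GaloisDegreePDefectlessVT`** (Kuhlmann 2010, Cor. 4.2 in the
value-transcendental case over an algebraically closed `K`): Galois extensions of degree `p` of
`K(x)^h` are defectless — from Props. 4.5 and 4.6, both PROVED. [cite: Kuhlmann2010, Cor. 4.2] -/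
theorem Kuhlmann2010GaloisDegreePDefectlessVT_holds : Kuhlmann2010GaloisDegreePDefectlessVT.{u} :=
  Kuhlmann2010GaloisDegreePDefectlessVT.of_props Kuhlmann2010Prop45ValueIndex_holds
    Kuhlmann2010Prop46ValueIndex_holds

/-- **DISCHARGE of `Kuhlmann2010HenselizedRationalImmediateExt`** (Kuhlmann 2010, §5, p. 19, the
italicized statement for `K(x)^h`: "Henselized inertially generated function fields of rank 1 and
of transcendence degree 1 with a valuation-transcendental generator over an algebraically closed
ground field do not admit proper immediate algebraic extensions", value-transcendental case).
PROVED (`Kuhlmann2010HenselizedRationalImmediateExt.of_prop46`).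
[cite: Kuhlmann2010, Section 5, proof of Thm. 1.1 (p. 19)] -/
theorem Kuhlmann2010HenselizedRationalImmediateExt_holds :
    Kuhlmann2010HenselizedRationalImmediateExt.{u} :=
  Kuhlmann2010HenselizedRationalImmediateExt.of_prop46 Kuhlmann2010Prop46ValueIndex_holds

/-- **DISCHARGE of `Kuhlmann2010Lemma55ValueTranscendental`** (Kuhlmann 2010, Lemma 5.5,
Case I). PROVED (`Kuhlmann2010Lemma55ValueTranscendental.of_immediateExt'`).
[cite: Kuhlmann2010, Lemma 5.5] -/
theorem Kuhlmann2010Lemma55ValueTranscendental_holds :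
    Kuhlmann2010Lemma55ValueTranscendental.{u} :=
  Kuhlmann2010Lemma55ValueTranscendental.of_immediateExt'
    Kuhlmann2010HenselizedRationalImmediateExt_holds

/-- **DISCHARGE of `Kuhlmann2010StabilityHenselizedRationalValueTranscendental`** (Kuhlmann 2010,
§5: `K(x)^h` of rank one with a value-transcendental generator over an algebraically closed `K` is
a defectless field). PROVED (Ostrowski's lemma and the italicized statement of §5 being proved).
[cite: Kuhlmann2010, Section 5, proof of Thm. 1.1 (pp. 18–20)] -/
theorem Kuhlmann2010StabilityHenselizedRationalValueTranscendental_holds :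
    Kuhlmann2010StabilityHenselizedRationalValueTranscendental.{u} :=
  Kuhlmann2010StabilityHenselizedRationalValueTranscendental.of_ostrowski_of_immediateExt
    Kuhlmann2010OstrowskiLemma_holds Kuhlmann2010HenselizedRationalImmediateExt_holds

/-- **DISCHARGE of `Kuhlmann2010StabilityRankOneValueTranscendental`** (Kuhlmann 2010, (R4) for
`K(t)` of rank one with a value-transcendental generator over an algebraically closed `K`).
PROVED. [cite: Kuhlmann2010, Section 5, Lemma 5.4 (R4) and proof of (R4) (pp. 18–20)] -/
theorem Kuhlmann2010StabilityRankOneValueTranscendental_holds :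
    Kuhlmann2010StabilityRankOneValueTranscendental.{u} :=
  Kuhlmann2010StabilityRankOneValueTranscendental.of_ostrowski_of_immediateExt
    Kuhlmann2010OstrowskiLemma_holds Kuhlmann2010HenselizedRationalImmediateExt_holds

/-- **Kuhlmann 2010, Thm. 1.1 over a trivially valued ground field, from Props. 4.12–4.13 alone**
(the residue-transcendental normal forms `Kuhlmann2010GaloisResidueDegreeEqChar`,
`Kuhlmann2010Prop413ResidueDegree`), Prop. 4.6 being PROVED: the remaining trust base of
`Kuhlmann2010Stability` (`Kuhlmann2010Stability.of_leaves`). [cite: Kuhlmann2010, Thm. 1.1] -/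
theorem Kuhlmann2010Stability.of_residueLeaves (h412 : Kuhlmann2010GaloisResidueDegreeEqChar.{u})
    (h413 : Kuhlmann2010Prop413ResidueDegree.{u}) : Kuhlmann2010Stability.{u} :=
  Kuhlmann2010Stability.of_leaves Kuhlmann2010Prop46ValueIndex_holds h412 h413

end Literature.AlgebraicGeometry.Resolution
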